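import Literature.NumberTheory.EllipticCurves.BSDHeegnerPoints
import Literature.NumberTheory.EllipticCurves.BSDRootNumberSmallConductorProofs
import Literature.NumberTheory.EllipticCurves.FormalGroup
import Literature.NumberTheory.EllipticCurves.Tamagawa
import Literature.NumberTheory.EllipticCurves.PAdicHeights
import Mathlib.NumberTheory.LegendreSymbol.JacobiSymbol
import HarnessLib

/-!
# Kriz–Li 2019, Theorem 5.1 (2) (= arXiv:1606.03172 Thm. 1.12): the `2`-part of BSD TRANSPORTED
# along the explicit quadratic twists `E^{(d)}`, `d ∈ 𝒩`, of a curve `E/ℚ` with `E(ℚ)[2] = 0`,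
# and Theorem 4.3 (= arXiv Thm. 3.3): their analytic ranks — AS PRINTED

Source: D. Kriz, C. Li, *Goldfeld's conjecture and congruences between Heegner points*, Forum Math.
Sigma 7 (2019), e15, doi:10.1017/fms.2019.9 (PUBLISHED, refereed; §§1–6 = arXiv:1606.03172
*Congruences between Heegner points and quadratic twists of elliptic curves*). Texts materialised on
the hub: `paper:doi-10-1017-fms-2019-9` (journal numbering: Thm. 1.12, Def. 4.1, Thm. 4.3,
Thm. 5.1, Lemma 5.4) and `paper:arxiv-1606.03172` (LaTeX text, arXiv numbering: Thm. 1.4,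
Def. 3.1, Thm. 3.3, Thm. 1.12, Lemma 4.1); locators `pNNNN.txt:L<n>` below refer to the arXiv
materialisation unless marked FMS. VoR page/line locators (publisher PDF, store key
`paper:url-be4c8b95ec35`, `pNN` = journal page; located by the ARM P reader r13 S6,
`sheets/r13-S6/texts-S6-KL19two-decisive-lines.md` f6d397b9bcd0b330, DD-117): Def. 4.1 = p. 27
L14–19 · Thm. 4.3 = p. 28 L2–19 · Thm. 5.1 = p. 30 L43–50 · Rem. 5.2 = p. 31 L2–5 · (17) and
Lemma 5.4 = p. 32 L2–17 (Rem. 1.17 = p. 6 L34–37; the standing data of §1.4 = p. 4 L26–p. 5 L9).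
Named facts (`def … : Prop`, D-0014), nothing asserted.
Requested by the cell `b2b-bsdres`, sub-lane `bsd-p2`, mandate (v) ("2-adic transport"): this is a
PRINTED theorem carrying `BSD(2)` from two curves (`E`, `E^{(d_K)}`) to infinitely many quadratic
twists of a NON-CM curve with `Gal(ℚ(E[2])/ℚ) ≅ S₃` or `ℤ/3` ("Since the Iwasawa main conjecture is
not known for `p = 2`, the only known way to prove BSD(2) over `ℚ` is to compute the 2-part of both
sides … explicitly", p0016 L7).

Setting (p0003 L30–L38, verbatim): "Let `E/ℚ` be an elliptic curve of conductor `N`. Throughout this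
article, we will use `K = ℚ(√d_K)` to denote an imaginary quadratic field of fundamental
discriminant `d_K` satisfying the Heegner hypothesis for `N`: each prime factor `ℓ` of `N` is split
in `K`. We denote by `P ∈ E(K)` the corresponding Heegner point, defined up to sign and torsion with
respect to a fixed modular parametrization `π_E : X₀(N) → E`. Let `f(q) = Σ a_n(E) qⁿ` … be the
normalized newform associated to `E`. Let `ω_E ∈ Ω¹_{E/ℚ}` such that `π_E^*(ω_E) = f(q) · dq/q`.
We denote by `log_{ω_E}` the formal logarithm associated to `ω_E`. Notice `ω_E` may differ from the
Néron differential by a scalar when `E` is not the optimal curve in its isogeny class."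
Assumption (★) (p0003 L45–L48; FMS Thm. 1.12 / §4): "`2` splits in `K` and
`|Ẽ^{ns}(𝔽₂)| · log_{ω_E}(P) / 2 ≢ 0 (mod 2)`."
Definition 3.1 (= FMS Def. 4.1; p0014 L13–L20): "we define the set `𝒮` consisting of primes
`ℓ ∤ 2N` such that `ℓ` splits in `K` [and] `Frob_ℓ ∈ Gal(ℚ(E[2])/ℚ)` has order `3`. We define `𝒩` to
be the set of all integers `d ≡ 1 (mod 4)` such that `|d|` is a square-free product of primes in
`𝒮`."

**Theorem 3.3** (= FMS Thm. 4.3; p0014 L29–L45, verbatim): "Suppose `E/ℚ` is an elliptic curve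
with `E(ℚ)[2] = 0`. Let `K` be an imaginary quadratic field satisfying the Heegner hypothesis for `N`.
Assume (★). Then for any `d ∈ 𝒩`: • We have
`|Ẽ^{(d),ns}(𝔽₂)| · log_{ω_{E^{(d)}}}(P^{(d)}) / 2 ≢ 0 (mod 2)`. In particular, `P^{(d)} ∈ E^{(d)}(K)`
is of infinite order and `E^{(d)}/K` has both algebraic and analytic rank one. • The rank part of
the BSD conjecture is true for `E^{(d)}/ℚ` and `E^{(d·d_K)}/ℚ`. One of them has both algebraic and
analytic rank one and the other has both algebraic and analytic rank zero. • `E^{(d)}/ℚ` (resp.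
`E^{(d·d_K)}/ℚ`) has the same rank as `E/ℚ` if and only if `ψ_d(−N) = 1` (resp. `ψ_d(−N) = −1`),
where `ψ_d` is the quadratic character associated to `ℚ(√d)/ℚ`."

**Theorem 1.12** (= FMS Thm. 5.1; p0004 L32–L42, verbatim): "Let `E/ℚ` be an elliptic curve with
`E(ℚ)[2] = 0`. Assume there is an imaginary quadratic field `K` satisfying the Heegner hypothesis
for `N` and Assumption (★). Further assume that the local Tamagawa number `c₂(E)` is odd. If `E` has
additive reduction at `2`, further assume its Manin constant is odd. Let `𝒮` be the set of primes
`𝒮 = {ℓ ∤ 2N : ℓ splits in K, Frob_ℓ ∈ Gal(ℚ(E[2])/ℚ) has order 3}`. Let `𝒩` be the set of all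
integers `d ≡ 1 (mod 4)` such that `|d|` is a square-free product of primes in `𝒮`. We have:
• If BSD(2) is true for `E/K`, then BSD(2) is true for `E^{(d)}/K`, for any `d ∈ 𝒩`.
• If BSD(2) is true for `E/ℚ` and `E^{(d_K)}/ℚ`, then BSD(2) is true for `E^{(d)}/ℚ` and
`E^{(d·d_K)}/ℚ`, for any `d ∈ 𝒩` such that `χ_d(−N) = 1`." Remark 1.13 (p0004 L45): "BSD(2) for a
single elliptic curve (of small conductor) can be proved by numerical calculation when `r ≤ 1` (see
[Miller2011] for curves of conductor at most 5000). Theorem 1.12 then allows one to deduce BSD(2)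
for many of its quadratic twists (of arbitrarily large conductor)."

## Transcription (tree vocabulary; every hypothesis a binder)

* `E` = a GLOBALLY MINIMAL model `W/ℚ` (`[W.IsGloballyMinimal]`, so `ω_W` is the Néron differential
  and `a_p = W.frobeniusTrace p`); `N = W.conductorNorm ℤ`; "`E(ℚ)[2] = 0`": every `P ∈ W(ℚ)` with
  `2 • P = 0` is `0`.
* `K`, Heegner hypothesis: `IsImaginaryQuadratic K`, `SatisfiesHeegnerHypothesis N K`
  (`HeegnerPoints.lean`); "`2` splits in `K`": two primes of `𝓞 K` above `2`; the Heegner point and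
  the parametrisation: a datum `Dt : ModularParametrizationData W N` (its `Dt.c` IS the printed
  scalar `c_E` with `c_E · ω_E = ω_𝓔`, p0016 L31: `φ^*ω_W = c · 2πi f(z) dz = c · f(q) dq/q`), a
  Heegner datum `H`, an embedding `ι : K → ℂ` and `P ∈ E(K)` with `P ↦ heegnerPointComplex Dt H`
  (exactly the binders of the tree's `gross_zagier` / `CaiShuTian2014.thm11_trivialChar`).
* `log_{ω_E}(P)` at the prime `2`: choose a field embedding `j : K →ₐ[ℚ] ℚ₂` (exists iff `2` splits
  or ramifies in `K`; we quantify over it), push `P` to `P₂ ∈ E(ℚ₂)` (`Affine.Point.map j`), and use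
  the tree's `2`-adic formal logarithm `padicLogPoint` of `W/ℚ₂` (`FormalGroup.lean`: `log_W(z(Q))`
  for `Q` in the kernel of reduction `E₁(ℚ₂)`), extended to `E(ℚ₂)` in the only possible
  `ℚ`-linear way: with `n₂ = |Ẽ^{ns}(𝔽₂)|` and `c₂ = c₂(E)` the point `(c₂ n₂) • P₂` lies in
  `E₁(ℚ₂)` (`[E(ℚ₂) : E₀(ℚ₂)] = c₂`, `E₀/E₁ ≅ Ẽ^{ns}(𝔽₂)`), and
  `n₂ · log_{ω_E}(P) = n₂ · log_W(P₂)/c_E = log_W((c₂n₂) • P₂) / (c₂ · c_E)`.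
  So (★) reads: `2` splits in `K` and `v₂( log_W((c₂ n₂) • P₂) / (c₂ c_E) ) = 1`, i.e. the `2`-adic
  norm of that element of `ℚ₂` is `1/2` ("`x/2 ≢ 0 (mod 2)`" for the `2`-integral `x`, Remark 3.10
  of the arXiv text: "both sides … are p-integral"). This reading is a gloss forced by the absence
  of a tree name for `log_{ω_E}` on all of `E(ℚ₂)`; it is the authors' own computation recipe
  (Example 5.1/6.1: "`5P` … reduces to `∞ ∈ Ẽ(𝔽₂)` … `log_{ω_E} P = log_{ω_E} 5P`" up to a unit).
* `|Ẽ^{ns}(𝔽₂)|` (Remark 1.17 of FMS / arXiv p0002: "`ℓ + 1 − a_ℓ(E)` if `ℓ ∤ N`, `ℓ ± 1` if `ℓ ∥ N`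
  and `ℓ` if `ℓ² ∣ N`"): `nsPointCountAtTwo W` := `3 − a₂` (good), `1` (split multiplicative),
  `3` (non-split multiplicative), `2` (additive) — via the tree's reduction predicates at `2`.
* `c₂(E) = (W.baseChange ℚ_[2]).localTamagawaNumber ℤ_[2]` (`Tamagawa.lean`); "Manin constant odd
  if additive at 2": `¬ good ∧ ¬ multiplicative at 2 → Odd Dt.c`.
* `ℓ ∈ 𝒮`: `ℓ` prime, `ℓ ∤ 2N`, `ℓ` splits in `K`, and "`Frob_ℓ` has order `3` on `E[2]`" ⟺ the
  `2`-division cubic has no root mod `ℓ` ⟺ `Ẽ(𝔽_ℓ)[2] = 0` ⟺ `#Ẽ(𝔽_ℓ) = ℓ + 1 − a_ℓ` is odd ⟺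
  `a_ℓ(E)` is odd (the authors' own reading, p0014 L57–L58: "Since `Frob_ℓ` is order 3 on `E[2]`,
  we know that its trace `a_ℓ(E) ≡ 1 (mod 2)`"; conversely an even `#Ẽ(𝔽_ℓ)` forces a rational
  `2`-torsion point, i.e. a fixed root, i.e. order `1` or `2`): `Odd (W.frobeniusTrace ℓ)`.
  `d ∈ 𝒩`: `d ≡ 1 (mod 4)`, `|d|` squarefree, every prime factor of `|d|` in `𝒮`.
* `χ_d(−N) = 1` (`χ_d = ψ_d` the character of `ℚ(√d)/ℚ`): for `d ≡ 1 (mod 4)` with `|d|` odd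
  squarefree and `gcd(d, N) = 1`, `χ_d(−N) = χ_d(−1) χ_d(N) = sgn(d) · (N / |d|)` (Jacobi symbol;
  quadratic reciprocity for the Kronecker symbol of a discriminant `≡ 1 (mod 4)`), transcribed
  `Int.sign d * jacobiSym N |d| = 1`; EQUIVALENTLY (the authors' third bullet of Thm. 3.3 and
  p0014 L76–L78, `ε(E)ε(E^{(d)}) = ψ_d(−N)`): `E` and `E^{(d)}` have the same root number.
* "BSD(2)" over `ℚ`: Miller's `BSD(E, 2)` = the tree's `BSDp W' 2` (`BSDRootNumberSmallConductorProofs.lean`: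
  rank part ∧ `Ш[2^∞]` finite ∧ `#Ш_an ∈ ℚ` ∧ `ord₂ #Ш_an = ord₂ #Ш[2^∞]`), read on globally minimal
  models `W'` of the twists (`∃ C, C • W' = W.quadraticTwist d`, the idiom of `QuadraticTwist.lean`);
  this is the sense of Remark 1.13's pointer to Miller 2011 (`N < 5000`).
* Part (1) of Thm. 1.12 ("BSD(2) for `E/K` ⟹ BSD(2) for `E^{(d)}/K`") is NOT transcribed: the tree
  has no `BSD(2)`-over-`K` predicate (its `BSDp` is over `ℚ`); Cor. 4.2 (p0016 L40–L42: "BSD(2) for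
  `E/K` is equivalent to that all the local Tamagawa numbers `c_ℓ(E)` are odd and `Ш(E/K)[2] = 0`",
  under (★) and `c₂` odd) is recorded in the lane's LIT-STATUS only.
  -- TODO(general form): part (1) over `K`; the general congruence Thm. 1.16/3.9 (any `p`, any
  -- `E ≡ E' mod p^m`); Thm. 1.4's counting corollary `N_r(E,X) ≫ X/log^{5/6} X`.

Nothing is asserted: users take `(h : thm112_bsdTwo_twist)` / `(h : thm33_rank_twist)`.
-/

noncomputable section

open scoped Classical

open NumberField WeierstrassCurve Literature.NumberTheory.EllipticCurves
  Literature.NumberTheory.EllipticCurves.ModularForms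

namespace Literature.NumberTheory.EllipticCurves.KrizLi2019

/-! ### The printed side data at the prime `2` -/

/-- `|Ẽ^{ns}(𝔽₂)|`, the number of `𝔽₂`-points of the nonsingular locus of the reduction mod `2` of a
globally minimal `W/ℚ` (Kriz–Li, FMS Remark 1.17 = arXiv p0002: "`ℓ + 1 − a_ℓ(E)` if `ℓ ∤ N`, `ℓ ± 1`
if `ℓ ∥ N` and `ℓ` if `ℓ² ∣ N`", at `ℓ = 2`): `3 − a₂` for good reduction, `1` for split
multiplicative (`Ẽ^{ns} ≅ 𝔾_m`), `3` for non-split multiplicative, `2` for additive (`Ẽ^{ns} ≅ 𝔾_a`).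
[cite: KrizLi2019, Rem. 1.17 (FMS) = arXiv:1606.03172 p0002 (|Ẽ^{ns}(𝔽_ℓ)|)] -/
def nsPointCountAtTwo (W : WeierstrassCurve ℚ) [W.IsGloballyMinimal] : ℕ :=
  haveI : Fact (2 : ℕ).Prime := ⟨Nat.prime_two⟩
  if W.HasGoodReductionAtPrime 2 then (3 - W.frobeniusTrace 2).toNat
  else if W.HasSplitMultiplicativeReductionAtPrime 2 then 1
  else if W.HasMultiplicativeReductionAtPrime 2 then 3
  else 2

/-- **`ℓ ∈ 𝒮`** (Kriz–Li Def. 3.1 = FMS Def. 4.1, p0014 L13–L18: "primes `ℓ ∤ 2N` such that `ℓ`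
splits in `K` [and] `Frob_ℓ ∈ Gal(ℚ(E[2])/ℚ)` has order `3`"), with "order `3`" read as
"`a_ℓ(E)` odd" (⟺ the `2`-division cubic is irreducible mod `ℓ` ⟺ `#Ẽ(𝔽_ℓ)` odd; the authors'
reading p0014 L57–L58; module docstring).
[cite: KrizLi2019, Def. 4.1 (FMS) = arXiv Def. 3.1 (p0014 L13–L20) (shape only; nothing asserted)] -/
def InS (W : WeierstrassCurve ℚ) [W.IsGloballyMinimal] (K : Type) [Field K] [NumberField K]
    (ℓ : ℕ) : Prop :=
  ℓ.Prime ∧ ¬ ℓ ∣ 2 * W.conductorNorm ℤ ∧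
    ((Ideal.span {(ℓ : ℤ)}).primesOver (𝓞 K)).ncard = 2 ∧ Odd (W.frobeniusTrace ℓ)

/-- **`d ∈ 𝒩`** (same Definition: "all integers `d ≡ 1 (mod 4)` such that `|d|` is a square-free
product of primes in `𝒮`"). [cite: KrizLi2019, Def. 4.1 (FMS) = arXiv Def. 3.1 (p0014 L20) (shape only; nothing asserted)] -/
def InN (W : WeierstrassCurve ℚ) [W.IsGloballyMinimal] (K : Type) [Field K] [NumberField K]
    (d : ℤ) : Prop :=
  d % 4 = 1 ∧ Squarefree d.natAbs ∧ ∀ ℓ : ℕ, ℓ.Prime → ℓ ∣ d.natAbs → InS W K ℓ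

/-- **Assumption (★) at the prime `2`** (arXiv p0003 L45–L48 = FMS Thm. 1.12/§4: "`2` splits in `K`
and `|Ẽ^{ns}(𝔽₂)| · log_{ω_E}(P) / 2 ≢ 0 (mod 2)`"), for a globally minimal `W/ℚ`, a
parametrisation datum `Dt` (whose `Dt.c` is the printed `c_E`, `c_E ω_E = ω_𝓔`), a point
`P ∈ E(K)` (the Heegner point) and a `ℚ`-embedding `j : K → ℚ₂` (a prime of `K` above `2`):
two primes of `𝓞 K` above `2`, and, with `n₂ = |Ẽ^{ns}(𝔽₂)|`, `c₂ = c₂(E)`, `P₂ = j(P) ∈ E(ℚ₂)`,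
the element `log_W((c₂ n₂) • P₂) / (c₂ · c_E)` of `ℚ₂` (`= n₂ · log_{ω_E}(P)`, module docstring) has
`2`-adic valuation exactly `1` (norm `2⁻¹`). A predicate; nothing asserted.
[cite: KrizLi2019, Assumption (★) (arXiv:1606.03172 p0003 L45–L48; FMS Thm. 1.12) (shape only; nothing asserted)] -/
def AssumptionStar (W : WeierstrassCurve ℚ) [W.IsGloballyMinimal] {N : ℕ} [NeZero N]
    (Dt : ModularParametrizationData W N) (K : Type) [Field K] [NumberField K]
    (P : (W.baseChange K).toAffine.Point) (j : K →ₐ[ℚ] ℚ_[2]) : Prop :=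
  haveI : Fact (2 : ℕ).Prime := ⟨Nat.prime_two⟩
  ((Ideal.span {(2 : ℤ)}).primesOver (𝓞 K)).ncard = 2 ∧
    ‖(W.baseChange ℚ_[2]).padicLogPoint
          ((((W.baseChange ℚ_[2]).localTamagawaNumber ℤ_[2]) * nsPointCountAtTwo W) •
            WeierstrassCurve.Affine.Point.map j P) /
        ((((W.baseChange ℚ_[2]).localTamagawaNumber ℤ_[2] : ℕ) : ℚ_[2]) * (Dt.c : ℚ_[2]))‖ =
      2⁻¹

/-! ### Theorem 3.3 (= FMS Thm. 4.3): analytic ranks of the explicit twists -/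

/-- **Kriz–Li 2019, Thm. 4.3 (FMS) = arXiv Thm. 3.3, second and third bullets** (p0014 L29–L45,
verbatim in the module docstring). For a globally minimal `W/ℚ` of conductor `N` with
`E(ℚ)[2] = 0`, an imaginary quadratic `K` with the Heegner hypothesis for `N`, a parametrisation
datum `Dt`, Heegner datum `H`, embedding `ι : K → ℂ` and Heegner point `P ∈ E(K)`
(`P ↦ heegnerPointComplex Dt H`) satisfying (★) for some `j : K → ℚ₂`, and any `d ∈ 𝒩`: on
globally minimal models `W₁` of `E^{(d)}` and `W₂` of `E^{(d·d_K)}`, both satisfy the rank part of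
BSD with `{r_an(E^{(d)}), r_an(E^{(d d_K)})} = {0, 1}`, and `r_an(E^{(d)}) = r_an(E)` iff
`χ_d(−N) = sgn(d)·(N/|d|) = 1`. (The first bullet — (★) propagates to `(E^{(d)}, P^{(d)})` — is
not transcribed separately: it is the mechanism.) Named fact (PUBLISHED); nothing asserted.
[cite: KrizLi2019, Thm. 4.3 (FMS, VoR p. 28 L2–19) = arXiv:1606.03172 Thm. 3.3 (p0014 L29–L45)] -/
def thm33_rank_twist : Prop :=
  ∀ (W : WeierstrassCurve ℚ) [W.IsElliptic] [W.IsGloballyMinimal] [NeZero (W.conductorNorm ℤ)],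
    (∀ Q : W.toAffine.Point, 2 • Q = 0 → Q = 0) →
    ∀ (K : Type) [Field K] [NumberField K], IsImaginaryQuadratic K →
      SatisfiesHeegnerHypothesis (W.conductorNorm ℤ) K →
    ∀ (Dt : ModularParametrizationData W (W.conductorNorm ℤ))
      (H : HeegnerDatum (W.conductorNorm ℤ) (NumberField.discr K)) (ι : K →+* ℂ)
      (P : (W.baseChange K).toAffine.Point),
      WeierstrassCurve.Affine.Point.map ι.toRatAlgHom P = heegnerPointComplex Dt H →
    ∀ (j : K →ₐ[ℚ] ℚ_[2]), AssumptionStar W Dt K P j →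
    ∀ (d : ℤ), InN W K d →
    ∀ (W₁ W₂ : WeierstrassCurve ℚ) [W₁.IsElliptic] [W₁.IsGloballyMinimal] [W₂.IsElliptic]
      [W₂.IsGloballyMinimal],
      (∃ C : VariableChange ℚ, C • W₁ = W.quadraticTwist (d : ℚ)) →
      (∃ C : VariableChange ℚ, C • W₂ = W.quadraticTwist ((d * NumberField.discr K : ℤ) : ℚ)) →
        W₁.mordellWeilRank = W₁.analyticRank ∧ W₂.mordellWeilRank = W₂.analyticRank ∧
          ((W₁.analyticRank = 1 ∧ W₂.analyticRank = 0) ∨ (W₁.analyticRank = 0 ∧ W₂.analyticRank = 1)) ∧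
          (W₁.analyticRank = W.analyticRank ↔ Int.sign d * jacobiSym (W.conductorNorm ℤ) d.natAbs = 1)

/-! ### Theorem 1.12 (2) (= FMS Thm. 5.1 (2)): BSD(2) transported to the twists -/

/-- **Kriz–Li 2019, Thm. 5.1 (2) (FMS) = arXiv:1606.03172 Thm. 1.12, second bullet** (p0004 L32–L42,
verbatim in the module docstring). For a globally minimal `W/ℚ` of conductor `N` with
`E(ℚ)[2] = 0`; an imaginary quadratic `K` with the Heegner hypothesis for `N`; a parametrisation
datum `Dt` (`Dt.c = c_E`), Heegner datum, embedding and Heegner point `P ∈ E(K)` with (★) at some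
`j : K → ℚ₂`; `c₂(E)` odd; `Dt.c` odd if `E` is additive at `2` (neither good nor multiplicative);
then for every `d ∈ 𝒩` with `χ_d(−N) = 1` (`sgn(d) · (N/|d|) = 1`): if `BSD(E, 2)` and
`BSD(E^{(d_K)}, 2)` hold (Miller's `BSDp · 2` on globally minimal models), then `BSD(E^{(d)}, 2)`
and `BSD(E^{(d·d_K)}, 2)` hold (on globally minimal models). Named fact (PUBLISHED); nothing
asserted; users take `(h : thm112_bsdTwo_twist)`.
[cite: KrizLi2019, Thm. 5.1 (2) (FMS, VoR p. 30 L43–50) = arXiv:1606.03172 Thm. 1.12 (p0004 L32–L42); Rem. 1.13 (p0004 L45) = FMS Rem. 5.2 (VoR p. 31 L2–5)] -/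
def thm112_bsdTwo_twist : Prop :=
  ∀ (W : WeierstrassCurve ℚ) [W.IsElliptic] [W.IsGloballyMinimal] [NeZero (W.conductorNorm ℤ)],
    (∀ Q : W.toAffine.Point, 2 • Q = 0 → Q = 0) →
    ∀ (K : Type) [Field K] [NumberField K], IsImaginaryQuadratic K →
      SatisfiesHeegnerHypothesis (W.conductorNorm ℤ) K →
    ∀ (Dt : ModularParametrizationData W (W.conductorNorm ℤ))
      (H : HeegnerDatum (W.conductorNorm ℤ) (NumberField.discr K)) (ι : K →+* ℂ)
      (P : (W.baseChange K).toAffine.Point),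
      WeierstrassCurve.Affine.Point.map ι.toRatAlgHom P = heegnerPointComplex Dt H →
    ∀ (j : K →ₐ[ℚ] ℚ_[2]), AssumptionStar W Dt K P j →
    (haveI : Fact (2 : ℕ).Prime := ⟨Nat.prime_two⟩;
      Odd ((W.baseChange ℚ_[2]).localTamagawaNumber ℤ_[2]) ∧
        (¬ W.HasGoodReductionAtPrime 2 → ¬ W.HasMultiplicativeReductionAtPrime 2 → Odd Dt.c)) →
    ∀ (W₀ : WeierstrassCurve ℚ) [W₀.IsElliptic] [W₀.IsGloballyMinimal],
      (∃ C : VariableChange ℚ, C • W₀ = W.quadraticTwist (NumberField.discr K : ℚ)) →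
      BSDp W 2 → BSDp W₀ 2 →
    ∀ (d : ℤ), InN W K d → Int.sign d * jacobiSym (W.conductorNorm ℤ) d.natAbs = 1 →
    ∀ (W₁ W₂ : WeierstrassCurve ℚ) [W₁.IsElliptic] [W₁.IsGloballyMinimal] [W₂.IsElliptic]
      [W₂.IsGloballyMinimal],
      (∃ C : VariableChange ℚ, C • W₁ = W.quadraticTwist (d : ℚ)) →
      (∃ C : VariableChange ℚ, C • W₂ = W.quadraticTwist ((d * NumberField.discr K : ℤ) : ℚ)) →
        BSDp W₁ 2 ∧ BSDp W₂ 2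

/-! ### Small proved API -/

/-- `d = 1` is (vacuously) in `𝒩` — the empty product; Theorems 3.3 / 1.12 are then statements about
`E` and `E^{(d_K)}` themselves. [cite: KrizLi2019, Def. 4.1 (FMS) (𝒩 contains the empty product)] -/
theorem inN_one (W : WeierstrassCurve ℚ) [W.IsGloballyMinimal] (K : Type) [Field K]
    [NumberField K] : InN W K 1 := by
  refine ⟨by decide, by simp, fun ℓ hℓ h ↦ ?_⟩
  exact absurd (Nat.eq_one_of_dvd_one (by simpa using h)) hℓ.ne_one

/-- Membership in `𝒮` forces `ℓ` odd and `ℓ ∤ N` (it is stated as `ℓ ∤ 2N`).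
[cite: KrizLi2019, Def. 4.1 (FMS) (ℓ ∤ 2N)] -/
theorem InS.not_dvd_conductor {W : WeierstrassCurve ℚ} [W.IsGloballyMinimal] {K : Type} [Field K]
    [NumberField K] {ℓ : ℕ} (h : InS W K ℓ) : ℓ ≠ 2 ∧ ¬ ℓ ∣ W.conductorNorm ℤ := by
  obtain ⟨hℓ, hnd, -, -⟩ := h
  refine ⟨?_, fun hd ↦ hnd (Dvd.dvd.mul_left hd 2)⟩
  rintro rfl
  exact hnd (dvd_mul_right 2 _)

end Literature.NumberTheory.EllipticCurves.KrizLi2019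

end
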